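import Summits.RiemannHypothesis.RiemannHypothesis.Theorems.TiltedLandingLaw421R3FLink

/-! # TiltedLandingLaw421R3FLinkGain — K-b′ on FLink v4d: the F-link `FLinkSig' θ` / `FLinkBoxSig' θ` shrinks to a two-point law for ONE analytic function (C4 «kernel desk» rh-idea-6 g41; LANDING CANDIDATE after RSV-76 ⇐ v4d)
Director-rh g28 (CA836)(3): «119 r2 (draft of record) re-bases r2 → r3 on v4's Box names after v4 bytes freeze».  Names here ARE C3 v4d's
(`pub/ideators/rh-idea-3/g52/flink/FLink-v4d-C3-g52.lean` e4438583d3b076a5 = RSV-76's key (CA848): `RhW08.FLink.linePt`, `FLinkSig'` = §3 (unbindered),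
`LineRemainderBoxSig` = §2′, `FLinkBoxSig'` = §3′, `FarFieldModulusLawBox` / `TModAllowanceBoxSig` = the box modulus law / the sink (§5), the SEAM
`LevelRemainderBox … j` (hypothesis-only) with its transport `lineRemainderAt_of_levelRemainderBox` (§6), and the PLUMBED twin `FarFieldModulusLawBoxPl` /
`TModAllowanceBoxPlSig` (§7) with their kernels): this is the LANDING CANDIDATE —
it imports the landed RSV-76 module `…Theorems.TiltedLandingLaw421R3FLink` (= v4d's bytes) and carries NO slice; uncheckable until that module lands.
WHAT IT PROVES (kernel; Mathlib + landed tree modules + `Literature.NumberTheory.LFunctions.analyticOrderAt_conj_conj` / `iteratedDeriv_conj_of_conj`,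
`Literature.Analysis.Complex.apply_conj_eq_conj` / `differentiable_iteratedDeriv_of_entire`; tree objects BY NAME: `RhW08.BurgersRate.levelField` /
`farFieldAt`, v4d's laws and kernels):
 PART A     — `lineRem f j v R p`: v4d's line-remainder EXPRESSION `φ_j(p) − Σᶠ_{f⁽ʲ⁾u = 0, |Re u − Re v| < R/2} m_u (p − u)⁻¹` at a GENERAL point `p`
              (§2′/§3/§3′ evaluate it at `p = linePt v w`; the index set is `v`'s OWN window, independent of `p`).  By isolation the index set is `{v, v̄}`
              (`nearSet_eq_pair`), so `lineRem = φ_j − m_v (· − v)⁻¹ − m_{v̄} (· − v̄)⁻¹` in closed form (`lineRem_eq`): ONE function, poles removed.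
 PART FRAME — on a legal frame (`EngineHyps5 2 …`): Schwarz reflection `f⁽ʲ⁾(z̄) = conj f⁽ʲ⁾(z)`, REFLECTION SYMMETRY OF MULTIPLICITIES `ord_{v̄} = ord_v`
              (`analyticOrderAt_conj_eq`), finite multiplicity `m_v ≥ 1` once `f⁽ʲ⁾ w ≠ 0` somewhere, `m_v = 1` for a simple zero.
 PART CHILD — ★ THE `1/m` IDENTITY: at a child `w` (`f⁽ʲ⁺¹⁾ w = 0`) of a lowest `v` of multiplicity `m`, `lineRem f j v R w = m · farFieldAt f j v w` EXACTLY
              (`lineRem_child_eq_mul_farFieldAt`; crit-1 CUT 45 (D) at kernel level), hence `‖farFieldAt f j v w‖ ≤ ‖lineRem f j v R w‖`.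
 PART LAW   — the typed socket `RemainderGainSig θ` (OPEN; binders = `FLinkSig'`'s verbatim): `‖lineRem(w)‖ ≤ ‖lineRem(linePt v w)‖ + θ·η/s` — a TWO-POINT
              COMPARISON OF ONE FUNCTION along the horizontal segment from the line point `p₀ = Re v + i·Im w` to the child.  ★★ `fLinkSig'_of_remainderGain :
              RemainderGainSig θ → FLinkSig' θ`; BY NAME through v4d: `farFieldModulusLawBox_of_remainderGain : LineRemainderBoxSig → RemainderGainSig θ →
              FarFieldModulusLawBox (1+θ)`, `tModAllowanceBox_of_remainderGain` (`0 ≤ θ`, `(1+θ)² ≤ 5/4`), and the PLUMBED sink from the gain law ALONE: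
              `farFieldModulusLawBoxPl_of_remainderGain : RemainderGainSig θ → FarFieldModulusLawBoxPl (1+θ)`, `tModAllowanceBoxPl_of_remainderGain`.
 PART BOX   — the BOX-BINDERED socket `RemainderGainBoxSig θ` (v4d's two binders `|Re v − x₀| ≤ R/2 → Im v ≤ hmax →` after `IsLowest …`, C′ verbatim):
              ★★ `fLinkBoxSig'_of_remainderGainBox : RemainderGainBoxSig θ → FLinkBoxSig' θ`, `remainderGainBox_of_remainderGain`, the sinks
              `tModAllowanceBox_of_remainderGainBox : LineRemainderBoxSig → RemainderGainBoxSig θ → … → TModAllowanceBoxSig` and (plumbed, gain law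
              alone) `tModAllowanceBoxPl_of_remainderGainBox : RemainderGainBoxSig θ → … → TModAllowanceBoxPlSig`.  The F1 side (box F1, cap law,
              books glue to `TiltedLandingLaw421R`) is C4's image 120 v3 «F1Box» (`RhW08.F1Box`), not this file.
 PART SIMPLE — for a SIMPLE lowest zero `lineRem f j v R = farFieldAt f j v` pointwise, so `RemainderGainSig θ` reads as the LATERAL GAIN C3's bench B-a
              measured (`lateralGain_of_remainderGain`; ≤ +0.03·η/s on charged model rows; allowance `θ ≤ √(5/4) − 1 ≈ 0.118`).
 PART AXIS  — toolkit for the line point at general level `j`: `‖linePt v w − Re v‖ = |Im w|`, the line point lies in the closed disc when the child does,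
              `f⁽ʲ⁾(linePt v w) ≠ 0` for a moving child (isolation).
HONEST READING.  (a) `RemainderGainSig θ` / `RemainderGainBoxSig θ` are HYPOTHESES (typed, OPEN), priced by C3/C6/crit-1; implied by nothing proved here,
NOT known to follow from ★.  (b) §2′ `LineRemainderBoxSig` stays C3's typed-open law; the seam `LevelRemainderBox` is a HYPOTHESIS ((CA848): no ∀-heredity law — very
probably dead as typed); no heredity is typed here.  (c) Nothing of image 118 / v3 §4 (withdrawn, NEG 10) is used.  Sorry-free; no type-class declarations, no custom syntax, no hidden
declarations, no option changes.  Nothing here bears on the truth of RH; RH is NOT proved; ⟨33346⟩/⟨33347⟩ OPEN; checked ≠ landed ≠ proved. -/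

noncomputable section

namespace RhW08.FLinkGain

open Complex Filter Topology
open scoped ComplexConjugate
open RhW08.Round1 RhW08.StSwap RhW08.Round2 RhW08.QuadW
open RhW08.SealSwap (PBot)
open RhW08.SealSwapQ RhW08.RateSplit RhW08.IsolatedTilt RhW08.FarStep RhW08.BurgersRate RhW08.PurseP RhW08.BurgersRateG3
open RhIdea6.G17.W07C7 RhIdea6.G17.W07C7.Rev6 RhIdea6.G18.W07C8.Law421BirthS RhIdea6.G19.W07C11.Seam
open RhIdea6.G20.W07C12.Frac RhIdea6.G20.W07C12.StColP RhW07.C12.FieldSplit RhIdea6.G21.W07C13.TentMax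
open RhW07.C14.TwoSided RhW07.C14.Classes RhW07.C14.Lineage RhW07.C14.Booking
open RhW08.FLink

/-! ## PART A — v3's line remainder as ONE function of the point -/

/-- v3's LINE-REMAINDER EXPRESSION at a general point `p`: the level field `φ_j(p)` minus its polar part over `v`'s OWN window
`|Re u − Re v| < R/2` (an index set independent of `p`).  v4d's `LineRemainderBoxSig` / `FLinkSig'` / `FLinkBoxSig'` (and the seam transport `lineRemainderAt_of_levelRemainderBox`) evaluate exactly this at `p = linePt v w`. -/
def lineRem (f : ℂ → ℂ) (j : ℕ) (v : ℂ) (R : ℝ) (p : ℂ) : ℂ :=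
  levelField f j p - ∑ᶠ u ∈ {u : ℂ | iteratedDeriv j f u = 0 ∧ |u.re - v.re| < R / 2},
    ((analyticOrderAt (iteratedDeriv j f) u).toNat : ℂ) * (p - u)⁻¹

/-- by `R/2`-isolation, `v`'s window set of zeros of `f⁽ʲ⁾` is exactly the pair `{v, v̄}`. -/
theorem nearSet_eq_pair {f : ℂ → ℂ} {j : ℕ} {v : ℂ} {R : ℝ}
    (hiso : ∀ z : ℂ, iteratedDeriv j f z = 0 → |z.re - v.re| < R / 2 → z = v ∨ z = conj v)
    (hFv : iteratedDeriv j f v = 0) (hFcv : iteratedDeriv j f (conj v) = 0) (hR : 0 < R) :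
    {u : ℂ | iteratedDeriv j f u = 0 ∧ |u.re - v.re| < R / 2} = {v, conj v} := by
  ext u
  simp only [Set.mem_setOf_eq, Set.mem_insert_iff, Set.mem_singleton_iff]
  constructor
  · rintro ⟨h0, hre⟩
    exact hiso u h0 hre
  · rintro (rfl | rfl)
    · exact ⟨hFv, by rw [sub_self, abs_zero]; linarith⟩
    · exact ⟨hFcv, by rw [Complex.conj_re, sub_self, abs_zero]; linarith⟩

/-- a point of the open upper half plane is not its own conjugate. -/
theorem ne_conj_of_im_pos {v : ℂ} (hv0 : 0 < v.im) : v ≠ conj v := by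
  intro h
  have him := congrArg Complex.im h
  simp only [Complex.conj_im] at him
  linarith

/-- the line remainder in CLOSED FORM: `lineRem(p) = φ_j(p) − (m_v (p − v)⁻¹ + m_{v̄} (p − v̄)⁻¹)` — no finsum left. -/
theorem lineRem_eq {f : ℂ → ℂ} {j : ℕ} {v : ℂ} {R : ℝ}
    (hiso : ∀ z : ℂ, iteratedDeriv j f z = 0 → |z.re - v.re| < R / 2 → z = v ∨ z = conj v)
    (hFv : iteratedDeriv j f v = 0) (hFcv : iteratedDeriv j f (conj v) = 0) (hR : 0 < R) (hv0 : 0 < v.im) (p : ℂ) :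
    lineRem f j v R p = levelField f j p
      - (((analyticOrderAt (iteratedDeriv j f) v).toNat : ℂ) * (p - v)⁻¹
        + ((analyticOrderAt (iteratedDeriv j f) (conj v)).toNat : ℂ) * (p - conj v)⁻¹) := by
  rw [lineRem, nearSet_eq_pair hiso hFv hFcv hR, finsum_mem_pair (ne_conj_of_im_pos hv0)]

/-! ## PART FRAME — what a legal frame (`EngineHyps5 2 …`) gives: a window, reflection, multiplicities -/

-- (a legal frame has a window `0 < R`: the TREE's `RhW08.ClusterQ.R_pos_of_engine`, cited by name — no restatement here)

/-- (K) every level of a legal frame is entire (`Literature.Analysis.Complex.differentiable_iteratedDeriv_of_entire`). -/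
theorem differentiable_level {η : ℝ} {f : ℂ → ℂ} {x₀ s hmax R Hs : ℝ} {B : ℕ} (hE : EngineHyps5 2 η f x₀ s hmax R Hs B) (j : ℕ) :
    Differentiable ℂ (iteratedDeriv j f) :=
  Literature.Analysis.Complex.differentiable_iteratedDeriv_of_entire hE.1 j

/-- (K) Schwarz reflection for every level on a legal frame: `f⁽ʲ⁾(z̄) = conj (f⁽ʲ⁾ z)` (`Literature.Analysis.Complex.apply_conj_eq_conj`,
`Literature.NumberTheory.LFunctions.iteratedDeriv_conj_of_conj`). -/
theorem iteratedDeriv_conj {η : ℝ} {f : ℂ → ℂ} {x₀ s hmax R Hs : ℝ} {B : ℕ} (hE : EngineHyps5 2 η f x₀ s hmax R Hs B) (j : ℕ) (z : ℂ) :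
    iteratedDeriv j f (conj z) = conj (iteratedDeriv j f z) :=
  Literature.NumberTheory.LFunctions.iteratedDeriv_conj_of_conj (Literature.Analysis.Complex.apply_conj_eq_conj hE.1 hE.2.1) j z

/-- ★ (K) REFLECTION SYMMETRY OF MULTIPLICITIES on a legal frame: `ord_{v̄} f⁽ʲ⁾ = ord_v f⁽ʲ⁾`
(`Literature.NumberTheory.LFunctions.analyticOrderAt_conj_conj` applied to `f⁽ʲ⁾ = conj ∘ f⁽ʲ⁾ ∘ conj`). -/
theorem analyticOrderAt_conj_eq {η : ℝ} {f : ℂ → ℂ} {x₀ s hmax R Hs : ℝ} {B : ℕ} (hE : EngineHyps5 2 η f x₀ s hmax R Hs B) (j : ℕ) (v : ℂ) :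
    analyticOrderAt (iteratedDeriv j f) (conj v) = analyticOrderAt (iteratedDeriv j f) v := by
  have hfun : (fun z ↦ conj (iteratedDeriv j f (conj z))) = iteratedDeriv j f := by
    funext z
    rw [iteratedDeriv_conj hE, conj_conj]
  have ha : AnalyticAt ℂ (iteratedDeriv j f) (conj (conj v)) := (differentiable_level hE j).analyticAt _
  have h := Literature.NumberTheory.LFunctions.analyticOrderAt_conj_conj ha
  rw [hfun, conj_conj] at h
  exact h

/-- (K) on a legal frame a zero `v` of `f⁽ʲ⁾` has FINITE multiplicity `m_v ≥ 1` as soon as `f⁽ʲ⁾ w ≠ 0` somewhere (identity principle). -/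
theorem one_le_order_toNat {η : ℝ} {f : ℂ → ℂ} {x₀ s hmax R Hs : ℝ} {B : ℕ} (hE : EngineHyps5 2 η f x₀ s hmax R Hs B) {j : ℕ} {v w : ℂ}
    (hFv : iteratedDeriv j f v = 0) (hw : iteratedDeriv j f w ≠ 0) : 1 ≤ (analyticOrderAt (iteratedDeriv j f) v).toNat := by
  have hFd := differentiable_level hE j
  have ha : AnalyticAt ℂ (iteratedDeriv j f) v := hFd.analyticAt v
  have htop : analyticOrderAt (iteratedDeriv j f) v ≠ ⊤ := by
    intro h
    rw [analyticOrderAt_eq_top] at h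
    have hU : AnalyticOnNhd ℂ (iteratedDeriv j f) Set.univ := fun z _ ↦ hFd.analyticAt z
    have hz := hU.eqOn_zero_of_preconnected_of_eventuallyEq_zero isPreconnected_univ (Set.mem_univ v) h (Set.mem_univ w)
    exact hw hz
  obtain ⟨n, hn⟩ := ENat.ne_top_iff_exists.mp htop
  have hn0 : n ≠ 0 := by
    intro h0
    rw [h0] at hn
    exact (ha.analyticOrderAt_eq_zero.mp hn.symm) hFv
  rw [← hn, ENat.toNat_coe]
  exact Nat.one_le_iff_ne_zero.mpr hn0

/-- (K) a simple zero of `f⁽ʲ⁾` has analytic order one (Mathlib `AnalyticAt.analyticOrderAt_eq_one_of_zero_deriv_ne_zero`). -/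
theorem analyticOrderAt_eq_one_of_simple {η : ℝ} {f : ℂ → ℂ} {x₀ s hmax R Hs : ℝ} {B : ℕ} (hE : EngineHyps5 2 η f x₀ s hmax R Hs B)
    {j : ℕ} {v : ℂ} (hFv : iteratedDeriv j f v = 0) (hs : iteratedDeriv (j + 1) f v ≠ 0) :
    analyticOrderAt (iteratedDeriv j f) v = 1 := by
  have hderiv : deriv (iteratedDeriv j f) v ≠ 0 := by
    rw [← iteratedDeriv_succ]; exact hs
  exact ((differentiable_level hE j).analyticAt v).analyticOrderAt_eq_one_of_zero_deriv_ne_zero hFv hderiv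

/-! ## PART CHILD — the `1/m` identity at a child of the lowest state -/

/-- at a child `w` (`f⁽ʲ⁺¹⁾ w = 0`) the level field vanishes. -/
theorem levelField_child {f : ℂ → ℂ} {j : ℕ} {w : ℂ} (hw' : iteratedDeriv (j + 1) f w = 0) : levelField f j w = 0 := by
  rw [levelField, hw', zero_div]

/-- … so the far field at a child is minus the bare pair kernel (crit-1 CUT 45 (L7)). -/
theorem farFieldAt_child {f : ℂ → ℂ} {j : ℕ} (v : ℂ) {w : ℂ} (hw' : iteratedDeriv (j + 1) f w = 0) :
    farFieldAt f j v w = -((w - v)⁻¹ + (w - conj v)⁻¹) := by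
  rw [farFieldAt, levelField_child hw']
  simp only [one_div]
  ring

/-- … and the line remainder at a child is minus `m_v` times the pair kernel (reflection: `m_{v̄} = m_v`). -/
theorem lineRem_child {η : ℝ} {f : ℂ → ℂ} {x₀ s hmax R Hs : ℝ} {B : ℕ} (hE : EngineHyps5 2 η f x₀ s hmax R Hs B) {j : ℕ} {v w : ℂ}
    (hFv : iteratedDeriv j f v = 0) (hv0 : 0 < v.im)
    (hiso : ∀ z : ℂ, iteratedDeriv j f z = 0 → |z.re - v.re| < R / 2 → z = v ∨ z = conj v) (hw' : iteratedDeriv (j + 1) f w = 0) :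
    lineRem f j v R w = -(((analyticOrderAt (iteratedDeriv j f) v).toNat : ℂ) * ((w - v)⁻¹ + (w - conj v)⁻¹)) := by
  have hFcv : iteratedDeriv j f (conj v) = 0 := by rw [iteratedDeriv_conj hE, hFv, map_zero]
  rw [lineRem_eq hiso hFv hFcv (RhW08.ClusterQ.R_pos_of_engine hE) hv0, analyticOrderAt_conj_eq hE, levelField_child hw']
  ring

/-- ★ (K) THE `1/m` IDENTITY: at a child of the lowest state, `lineRem f j v R w = m_v · farFieldAt f j v w` EXACTLY (crit-1 CUT 45 (D) at kernel
level: the child of an `m`-fold zero feels the cofactor field divided by `m`). -/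
theorem lineRem_child_eq_mul_farFieldAt {η : ℝ} {f : ℂ → ℂ} {x₀ s hmax R Hs : ℝ} {B : ℕ} (hE : EngineHyps5 2 η f x₀ s hmax R Hs B)
    {j : ℕ} {v w : ℂ} (hFv : iteratedDeriv j f v = 0) (hv0 : 0 < v.im)
    (hiso : ∀ z : ℂ, iteratedDeriv j f z = 0 → |z.re - v.re| < R / 2 → z = v ∨ z = conj v) (hw' : iteratedDeriv (j + 1) f w = 0) :
    lineRem f j v R w = ((analyticOrderAt (iteratedDeriv j f) v).toNat : ℂ) * farFieldAt f j v w := by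
  rw [lineRem_child hE hFv hv0 hiso hw', farFieldAt_child v hw']
  ring

/-- ★ (K) hence `‖farFieldAt f j v w‖ ≤ ‖lineRem f j v R w‖` at a MOVING child (`m_v ≥ 1` because `f⁽ʲ⁾ w ≠ 0`). -/
theorem norm_farFieldAt_le_norm_lineRem {η : ℝ} {f : ℂ → ℂ} {x₀ s hmax R Hs : ℝ} {B : ℕ} (hE : EngineHyps5 2 η f x₀ s hmax R Hs B)
    {j : ℕ} {v w : ℂ} (hFv : iteratedDeriv j f v = 0) (hv0 : 0 < v.im)
    (hiso : ∀ z : ℂ, iteratedDeriv j f z = 0 → |z.re - v.re| < R / 2 → z = v ∨ z = conj v) (hw : iteratedDeriv j f w ≠ 0)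
    (hw' : iteratedDeriv (j + 1) f w = 0) : ‖farFieldAt f j v w‖ ≤ ‖lineRem f j v R w‖ := by
  rw [lineRem_child_eq_mul_farFieldAt hE hFv hv0 hiso hw', norm_mul, Complex.norm_natCast]
  have h1 : (1 : ℝ) ≤ ((analyticOrderAt (iteratedDeriv j f) v).toNat : ℝ) := by
    exact_mod_cast one_le_order_toNat hE hFv hw
  exact le_mul_of_one_le_left (norm_nonneg _) h1

/-! ## PART LAW — the typed socket `RemainderGainSig θ` (OPEN) and K-b′: `RemainderGainSig θ → FLinkSig' θ` -/

/-- (T, OPEN) **REMAINDER GAIN LAW** `RemainderGainSig θ`: on a legal frame, at a charged far level with lowest state `v` and moving child `w` (binders =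
T-MOD′'s `RhW08.BurgersRateG3.FarFieldModulusLawA'` = v3's, verbatim), v3's line remainder — ONE function of the point, `lineRem f j v R`, analytic on
the strip `|Re p − Re v| < R/2` once the pair's poles are removed — grows by at most `θ·η/s` along the horizontal segment from the line point
`p₀ = linePt v w` to the child: `‖lineRem(w)‖ ≤ ‖lineRem(p₀)‖ + θ·η/s`.  On a simple `v` this is the benched lateral gain of `‖farFieldAt‖`
(`lateralGain_of_remainderGain`; C3 B-a: ≤ +0.03·η/s on charged model rows, allowance `θ ≤ √(5/4) − 1`).  A second-moment statement; implied by nothing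
proved here; NOT known to follow from ★. -/
def RemainderGainSig (θ : ℝ) : Prop :=
  ∀ (η : ℝ) (f : ℂ → ℂ) (x₀ s hmax R Hs : ℝ) (B : ℕ), EngineHyps5 2 η f x₀ s hmax R Hs B →
    ∀ (j : ℕ) (v w : ℂ), FarLevelQ η f x₀ s hmax R Hs B j → Charged (PTrkSQ PBot) StTrkDQ ReadyR2 η f x₀ s hmax R Hs B j →
      IsLowest StTrkDQ η f x₀ s hmax R Hs B j v → iteratedDeriv j f w ≠ 0 →
      (∀ z : ℂ, iteratedDeriv j f z = 0 → |z.re - v.re| < R / 2 → z = v ∨ z = conj v) →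
      iteratedDeriv (j + 1) f w = 0 → 0 < w.im → ‖w - (v.re : ℂ)‖ ≤ |v.im| →
        ‖levelField f j w
            - ∑ᶠ u ∈ {u : ℂ | iteratedDeriv j f u = 0 ∧ |u.re - v.re| < R / 2},
                ((analyticOrderAt (iteratedDeriv j f) u).toNat : ℂ) * (w - u)⁻¹‖ ≤
          ‖levelField f j (linePt v w)
              - ∑ᶠ u ∈ {u : ℂ | iteratedDeriv j f u = 0 ∧ |u.re - v.re| < R / 2},
                  ((analyticOrderAt (iteratedDeriv j f) u).toNat : ℂ) * (linePt v w - u)⁻¹‖ + θ * η / s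

/-- ★★ (K) **K-b′ ON v3**: the remainder gain law with allowance `θ` gives the F-link `FLinkSig' θ` — the `1/m` identity at the child, then the gain. -/
theorem fLinkSig'_of_remainderGain (θ : ℝ) (hG : RemainderGainSig θ) : FLinkSig' θ := by
  intro η f x₀ s hmax R Hs B hE j v w hfar hch hL hw hiso hw' hwim hd
  have hv : StColQ' η f x₀ s hmax R Hs B j v := hL.1
  obtain ⟨-, hFv, hv0, -⟩ := hv
  have h1 : ‖farFieldAt f j v w‖ ≤ ‖lineRem f j v R w‖ := norm_farFieldAt_le_norm_lineRem hE hFv hv0 hiso hw hw'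
  have h2 : ‖lineRem f j v R w‖ ≤ ‖lineRem f j v R (linePt v w)‖ + θ * η / s :=
    hG η f x₀ s hmax R Hs B hE j v w hfar hch hL hw hiso hw' hwim hd
  exact h1.trans h2

/-- (K) … hence v4d's BOX-BINDERED modulus law at `λ = 1 + θ` from §2′ `LineRemainderBoxSig` and the remainder gain law (by name through v4d's
`fLinkBox_of_fLink` and `farFieldModulusLawBox_of_fLinkBox`). -/
theorem farFieldModulusLawBox_of_remainderGain {θ : ℝ} (hL : LineRemainderBoxSig) (hG : RemainderGainSig θ) : FarFieldModulusLawBox (1 + θ) :=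
  farFieldModulusLawBox_of_fLinkBox hL (fLinkBox_of_fLink (fLinkSig'_of_remainderGain θ hG))

/-- (K) … hence v4d's named sink `TModAllowanceBoxSig` for `0 ≤ θ`, `(1+θ)² ≤ 5/4` (`tModAllowanceBox_of_fLinkBox`); the F1 side continues in C4's
image 120 v3 «F1Box» (`RhW08.F1Box`: box F1, the cap law `FarExcludedCapQ`, books glue to `TiltedLandingLaw421R`). -/
theorem tModAllowanceBox_of_remainderGain {θ : ℝ} (hL : LineRemainderBoxSig) (hG : RemainderGainSig θ) (hθ : 0 ≤ θ) (h54 : (1 + θ) ^ 2 ≤ 5 / 4) :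
    TModAllowanceBoxSig :=
  tModAllowanceBox_of_fLinkBox hL (fLinkBox_of_fLink (fLinkSig'_of_remainderGain θ hG)) hθ h54

/-- (K) … and v4d's PLUMBED sink from the remainder gain law ALONE (v4d §6/§7, (CA848): the per-level seam `LevelRemainderBox … j` is a HYPOTHESIS
of `FarFieldModulusLawBoxPl`, transported to the line point by C3's `lineRemainderAt_of_levelRemainderBox`; no ∀-heredity law exists any more). -/
theorem farFieldModulusLawBoxPl_of_remainderGain {θ : ℝ} (hG : RemainderGainSig θ) : FarFieldModulusLawBoxPl (1 + θ) :=
  farFieldModulusLawBoxPl_of_fLinkBox (fLinkBox_of_fLink (fLinkSig'_of_remainderGain θ hG))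

/-- (K) … hence v4d's plumbed named sink `TModAllowanceBoxPlSig` for `0 ≤ θ`, `(1+θ)² ≤ 5/4` (`tModAllowanceBoxPl_of_fLink`). -/
theorem tModAllowanceBoxPl_of_remainderGain {θ : ℝ} (hG : RemainderGainSig θ) (hθ : 0 ≤ θ) (h54 : (1 + θ) ^ 2 ≤ 5 / 4) : TModAllowanceBoxPlSig :=
  tModAllowanceBoxPl_of_fLink (fLinkSig'_of_remainderGain θ hG) hθ h54

/-! ## PART SIMPLE — the simple-zero face: the line remainder IS the far field, the gain IS the benched lateral gain -/

/-- (K) for a SIMPLE lowest zero the line remainder is the far field at EVERY point: `lineRem f j v R p = farFieldAt f j v p` (`m_v = m_{v̄} = 1`). -/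
theorem lineRem_eq_farFieldAt_of_simple {η : ℝ} {f : ℂ → ℂ} {x₀ s hmax R Hs : ℝ} {B : ℕ} (hE : EngineHyps5 2 η f x₀ s hmax R Hs B)
    {j : ℕ} {v : ℂ} (hFv : iteratedDeriv j f v = 0) (hs : iteratedDeriv (j + 1) f v ≠ 0) (hv0 : 0 < v.im)
    (hiso : ∀ z : ℂ, iteratedDeriv j f z = 0 → |z.re - v.re| < R / 2 → z = v ∨ z = conj v) (p : ℂ) :
    lineRem f j v R p = farFieldAt f j v p := by
  have hFcv : iteratedDeriv j f (conj v) = 0 := by rw [iteratedDeriv_conj hE, hFv, map_zero]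
  rw [lineRem_eq hiso hFv hFcv (RhW08.ClusterQ.R_pos_of_engine hE) hv0, analyticOrderAt_conj_eq hE, analyticOrderAt_eq_one_of_simple hE hFv hs, farFieldAt]
  simp only [ENat.toNat_one, Nat.cast_one, one_mul, one_div]
  ring

/-- (K) … so on a SIMPLE lowest zero `RemainderGainSig θ` delivers the LATERAL GAIN bound of the far-field modulus from the line point to the child —
the quantity C3's bench B-a measured: `‖farFieldAt f j v w‖ ≤ ‖farFieldAt f j v (linePt v w)‖ + θ·η/s`. -/
theorem lateralGain_of_remainderGain {θ : ℝ} (hG : RemainderGainSig θ)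
    {η : ℝ} {f : ℂ → ℂ} {x₀ s hmax R Hs : ℝ} {B : ℕ} (hE : EngineHyps5 2 η f x₀ s hmax R Hs B) {j : ℕ} {v w : ℂ}
    (hfar : FarLevelQ η f x₀ s hmax R Hs B j) (hch : Charged (PTrkSQ PBot) StTrkDQ ReadyR2 η f x₀ s hmax R Hs B j)
    (hL : IsLowest StTrkDQ η f x₀ s hmax R Hs B j v) (hs : iteratedDeriv (j + 1) f v ≠ 0) (hw : iteratedDeriv j f w ≠ 0)
    (hiso : ∀ z : ℂ, iteratedDeriv j f z = 0 → |z.re - v.re| < R / 2 → z = v ∨ z = conj v)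
    (hw' : iteratedDeriv (j + 1) f w = 0) (hwim : 0 < w.im) (hd : ‖w - (v.re : ℂ)‖ ≤ |v.im|) :
    ‖farFieldAt f j v w‖ ≤ ‖farFieldAt f j v (linePt v w)‖ + θ * η / s := by
  have hv : StColQ' η f x₀ s hmax R Hs B j v := hL.1
  obtain ⟨-, hFv, hv0, -⟩ := hv
  have h : ‖lineRem f j v R w‖ ≤ ‖lineRem f j v R (linePt v w)‖ + θ * η / s :=
    hG η f x₀ s hmax R Hs B hE j v w hfar hch hL hw hiso hw' hwim hd
  rwa [lineRem_eq_farFieldAt_of_simple hE hFv hs hv0 hiso w, lineRem_eq_farFieldAt_of_simple hE hFv hs hv0 hiso (linePt v w)] at h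

/-! ## PART AXIS — toolkit for the line point at a general level (v3 §5 / the attack on `FLinkSig'`) -/

/-- the line point sits at height `|Im w|` above the foot `Re v` of the axis. -/
theorem norm_linePt_sub (v w : ℂ) : ‖linePt v w - (v.re : ℂ)‖ = |w.im| := by
  have h : linePt v w - (v.re : ℂ) = (w.im : ℂ) * I := Complex.ext (by simp [linePt]) (by simp [linePt])
  rw [h, norm_mul, Complex.norm_real, Complex.norm_I, mul_one, Real.norm_eq_abs]

/-- a point of the closed axis-centred disc of radius `|Im v|` satisfies `(Re w − Re v)² + Im w² ≤ Im v²`. -/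
theorem sq_disc_of_norm_le {v w : ℂ} (hd : ‖w - (v.re : ℂ)‖ ≤ |v.im|) : (w.re - v.re) ^ 2 + w.im ^ 2 ≤ v.im ^ 2 := by
  have hn : ‖w - (v.re : ℂ)‖ ^ 2 = (w.re - v.re) ^ 2 + w.im ^ 2 := by
    rw [Complex.sq_norm, Complex.normSq_apply]
    simp only [Complex.sub_re, Complex.ofReal_re, Complex.sub_im, Complex.ofReal_im, sub_zero]
    ring
  rw [← hn, ← sq_abs v.im]
  exact pow_le_pow_left₀ (norm_nonneg _) hd 2

/-- the line point lies in the closed disc whenever the child does (`|Im w| ≤ ‖w − Re v‖`). -/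
theorem linePt_mem_disc {v w : ℂ} (hd : ‖w - (v.re : ℂ)‖ ≤ |v.im|) : ‖linePt v w - (v.re : ℂ)‖ ≤ |v.im| := by
  rw [norm_linePt_sub]
  have h : |(w - (v.re : ℂ)).im| ≤ ‖w - (v.re : ℂ)‖ := Complex.abs_im_le_norm _
  simp only [Complex.sub_im, Complex.ofReal_im, sub_zero] at h
  exact h.trans hd

/-- `f⁽ʲ⁾` does not vanish at the line point of a MOVING child: by isolation a zero there is `v` or `v̄`; `v̄` has the wrong sign, and `v` would put the
child at the top of the disc, i.e. `w = v`, contradicting `f⁽ʲ⁾ w ≠ 0`. -/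
theorem iteratedDeriv_linePt_ne_zero {f : ℂ → ℂ} {j : ℕ} {v w : ℂ} {R : ℝ}
    (hiso : ∀ z : ℂ, iteratedDeriv j f z = 0 → |z.re - v.re| < R / 2 → z = v ∨ z = conj v)
    (hv0 : 0 < v.im) (hwim : 0 < w.im) (hd : ‖w - (v.re : ℂ)‖ ≤ |v.im|) (hw : iteratedDeriv j f w ≠ 0) (hR : 0 < R) :
    iteratedDeriv j f (linePt v w) ≠ 0 := by
  intro h0
  have hre : |(linePt v w).re - v.re| < R / 2 := by
    rw [linePt_re, sub_self, abs_zero]; linarith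
  rcases hiso _ h0 hre with h | h
  · have him : w.im = v.im := by
      have hh := congrArg Complex.im h
      rwa [linePt_im] at hh
    have h1 := sq_disc_of_norm_le hd
    rw [him] at h1
    have h2 : (w.re - v.re) ^ 2 = 0 := le_antisymm (by linarith) (sq_nonneg _)
    have hre0 : w.re = v.re := sub_eq_zero.mp ((pow_eq_zero_iff two_ne_zero).mp h2)
    have hwv : linePt v w = w := Complex.ext (by rw [linePt_re, hre0]) (by rw [linePt_im])
    rw [hwv] at h0
    exact hw h0
  · have him : w.im = -v.im := by
      have hh := congrArg Complex.im h
      rwa [linePt_im, Complex.conj_im] at hh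
    linarith

/-! ## PART BOX — the BOX-BINDERED socket (crit-1's C′ binder, v4d §5): `RemainderGainBoxSig θ` feeds `FLinkBoxSig' θ` and the sink -/

/-- (T, OPEN) **REMAINDER GAIN LAW, BOX-BINDERED** `RemainderGainBoxSig θ`: `RemainderGainSig θ` with v4d's two binders `|Re v − x₀| ≤ R/2 → Im v ≤ hmax →`
right after `IsLowest …` (token-parallel to `RhW08.FLink.FLinkBoxSig'`): levels whose lowest state is a lateral ENTRANT or sits above the box are outside
its scope (crit-1 X3: every failing row violates the binder). -/
def RemainderGainBoxSig (θ : ℝ) : Prop :=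
  ∀ (η : ℝ) (f : ℂ → ℂ) (x₀ s hmax R Hs : ℝ) (B : ℕ), EngineHyps5 2 η f x₀ s hmax R Hs B →
    ∀ (j : ℕ) (v w : ℂ), FarLevelQ η f x₀ s hmax R Hs B j → Charged (PTrkSQ PBot) StTrkDQ ReadyR2 η f x₀ s hmax R Hs B j →
      IsLowest StTrkDQ η f x₀ s hmax R Hs B j v → |v.re - x₀| ≤ R / 2 → v.im ≤ hmax → iteratedDeriv j f w ≠ 0 →
      (∀ z : ℂ, iteratedDeriv j f z = 0 → |z.re - v.re| < R / 2 → z = v ∨ z = conj v) →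
      iteratedDeriv (j + 1) f w = 0 → 0 < w.im → ‖w - (v.re : ℂ)‖ ≤ |v.im| →
        ‖levelField f j w
            - ∑ᶠ u ∈ {u : ℂ | iteratedDeriv j f u = 0 ∧ |u.re - v.re| < R / 2},
                ((analyticOrderAt (iteratedDeriv j f) u).toNat : ℂ) * (w - u)⁻¹‖ ≤
          ‖levelField f j (linePt v w)
              - ∑ᶠ u ∈ {u : ℂ | iteratedDeriv j f u = 0 ∧ |u.re - v.re| < R / 2},
                  ((analyticOrderAt (iteratedDeriv j f) u).toNat : ℂ) * (linePt v w - u)⁻¹‖ + θ * η / s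

/-- (K) drop two binders: the unrestricted gain law implies the box-bindered one. -/
theorem remainderGainBox_of_remainderGain {θ : ℝ} (h : RemainderGainSig θ) : RemainderGainBoxSig θ :=
  fun η f x₀ s hmax R Hs B hE j v w hfar hch hlow _hcol _hh hw0 hiso hw1 hwim hdisc =>
    h η f x₀ s hmax R Hs B hE j v w hfar hch hlow hw0 hiso hw1 hwim hdisc

/-- ★★ (K) **K-b′, BOX-BINDERED**: the box-bindered remainder gain law gives v4d's §3′ `FLinkBoxSig' θ` (same `1/m` identity + gain; the two box binders
are only threaded). -/
theorem fLinkBoxSig'_of_remainderGainBox (θ : ℝ) (hG : RemainderGainBoxSig θ) : FLinkBoxSig' θ := by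
  intro η f x₀ s hmax R Hs B hE j v w hfar hch hL hcol hh hw hiso hw' hwim hd
  have hv : StColQ' η f x₀ s hmax R Hs B j v := hL.1
  obtain ⟨-, hFv, hv0, -⟩ := hv
  have h1 : ‖farFieldAt f j v w‖ ≤ ‖lineRem f j v R w‖ := norm_farFieldAt_le_norm_lineRem hE hFv hv0 hiso hw hw'
  have h2 : ‖lineRem f j v R w‖ ≤ ‖lineRem f j v R (linePt v w)‖ + θ * η / s :=
    hG η f x₀ s hmax R Hs B hE j v w hfar hch hL hcol hh hw hiso hw' hwim hd
  exact h1.trans h2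

/-- (K) … hence the box-bindered modulus law at `λ = 1 + θ` from §2′ and the BOX gain law (v4d's `farFieldModulusLawBox_of_fLinkBox`, by name). -/
theorem farFieldModulusLawBox_of_remainderGainBox {θ : ℝ} (hL : LineRemainderBoxSig) (hG : RemainderGainBoxSig θ) :
    FarFieldModulusLawBox (1 + θ) :=
  farFieldModulusLawBox_of_fLinkBox hL (fLinkBoxSig'_of_remainderGainBox θ hG)

/-- (K) … hence the sink `TModAllowanceBoxSig` from §2′ and the BOX gain law (`0 ≤ θ`, `(1+θ)² ≤ 5/4`). -/
theorem tModAllowanceBox_of_remainderGainBox {θ : ℝ} (hL : LineRemainderBoxSig) (hG : RemainderGainBoxSig θ) (hθ : 0 ≤ θ)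
    (h54 : (1 + θ) ^ 2 ≤ 5 / 4) : TModAllowanceBoxSig :=
  tModAllowanceBox_of_fLinkBox hL (fLinkBoxSig'_of_remainderGainBox θ hG) hθ h54

/-- (K) … and v4d's PLUMBED modulus law / sink from the BOX gain law ALONE (`farFieldModulusLawBoxPl_of_fLinkBox`, `tModAllowanceBoxPl_of_fLinkBox`). -/
theorem farFieldModulusLawBoxPl_of_remainderGainBox {θ : ℝ} (hG : RemainderGainBoxSig θ) : FarFieldModulusLawBoxPl (1 + θ) :=
  farFieldModulusLawBoxPl_of_fLinkBox (fLinkBoxSig'_of_remainderGainBox θ hG)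

/-- (K) the plumbed sink `TModAllowanceBoxPlSig` from the BOX gain law alone (`0 ≤ θ`, `(1+θ)² ≤ 5/4`) — the F-link's typed-open analytic content on
C4's side is then the ONE law `RemainderGainBoxSig θ` (the seam is discharged per (frame, level) by whoever certifies it). -/
theorem tModAllowanceBoxPl_of_remainderGainBox {θ : ℝ} (hG : RemainderGainBoxSig θ) (hθ : 0 ≤ θ) (h54 : (1 + θ) ^ 2 ≤ 5 / 4) :
    TModAllowanceBoxPlSig :=
  tModAllowanceBoxPl_of_fLinkBox (fLinkBoxSig'_of_remainderGainBox θ hG) hθ h54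

end RhW08.FLinkGain

end
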